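import Mathlib.Algebra.Order.BigOperators.Group.Finset
import Literature.LinearAlgebra.QuadraticForm.MetabolicSpacesPi
import HarnessLib

/-!
# Quadratic (metabolic) Selmer structures and the Klagsbrun–Mazur–Rubin comparison theorem

Topic `Literature/NumberTheory/EllipticCurves` (definition request `defn-quadraticSelmerStructure`,
wanted by `stmt-Parity-11584` = crux `IsogenyRedei.PencilSelmerDictionary`, line
`isotrivial-two-torsion-relative-parity`).  Source: Z. Klagsbrun, B. Mazur, K. Rubin, *Disparity in
Selmer ranks of quadratic twists of elliptic curves*, Ann. of Math. 178 (2013), §3 "Metabolic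
structures and Selmer structures" [KlagsbrunMazurRubin2013] (read: arXiv:1111.2321 TeX, held as
`paper:arxiv-1111.2321`; numbering Thm 3.1 / Def 3.2 / Def 3.3 / Lemma 3.4 / Rem 3.5 / Def 3.6 /
Lemma 3.7 / Def 3.8 / Thm 3.9 checked against the source's shared `\newtheorem` counter), building
on the metabolic-space vocabulary of §2 already in the tree
(`Literature.LinearAlgebra.QuadraticForm.IsLagrangian`, `IsMetabolic`, KMR Lemma 2.2 – Cor. 2.5 and
the algebraic skeleton of Thm 3.9, file `LinearAlgebra/QuadraticForm/MetabolicSpaces.lean`;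
orthogonal sums in `MetabolicSpacesPi.lean`).

## KMR §3, as printed

`T` is a finite `𝔽_p[G_K]`-module with a perfect alternating pairing `T × T → μ_p`, `Σ` a finite set
of places containing the archimedean ones, those above `p` and those where `T` ramifies; for
`v ∉ Σ`, `H¹_ur(K_v, T) ⊂ H¹(K_v, T)` is the unramified subgroup.  **Thm 3.1** (Tate): the local
Tate pairings `⟨ , ⟩_v` on `H¹(K_v, T)` are symmetric and nondegenerate, `H¹_ur(K_v, T)` is its own
orthogonal complement for `v ∉ Σ`, and `∑_v ⟨c_v, d_v⟩_v = 0` for global `c, d`.  **Def 3.2**: `q`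
is a *Tate quadratic form* on `H¹(K_v, T)` if its polar form is `⟨ , ⟩_v`; for `v ∉ Σ` it is
*unramified* if `q(H¹_ur(K_v, T)) = 0`.  **Def 3.3**: a *global metabolic structure* `𝐪 = (q_v)_v` on
`T` consists of a Tate quadratic form `q_v` on each `H¹(K_v, T)` such that (i) every
`(H¹(K_v, T), q_v)` is a metabolic space, (ii) `q_v` is unramified for `v ∉ Σ`, (iii)
`∑_v q_v(c_v) = 0` for every `c ∈ H¹(K, T)` (a finite sum, as `c_v ∈ H¹_ur` for almost all `v`).
**Def 3.6**: `H(q_v)` = the set of Lagrangian subspaces of `(H¹(K_v, T), q_v)`,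
`H_ram(q_v) = {X ∈ H(q_v) : X ∩ H¹_ur(K_v, T) = 0}`.  **Def 3.8**: a *Selmer structure* `𝒮` for
`(T, 𝐪)` is a finite set of places `Σ_𝒮 ⊇ Σ` and a Lagrangian `H¹_𝒮(K_v, T) ⊂ H¹(K_v, T)` for each
`v ∈ Σ_𝒮`; one sets `H¹_𝒮(K_v, T) := H¹_ur(K_v, T)` for `v ∉ Σ_𝒮` and
`H¹_𝒮(K, T) := {c ∈ H¹(K, T) : c_v ∈ H¹_𝒮(K_v, T) for every v}`.  **Thm 3.9**: for two Selmer
structures `𝒮, 𝒮'`,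
`dim H¹_𝒮(K, T) − dim H¹_𝒮'(K, T) ≡ ∑_{v ∈ Σ_𝒮 ∪ Σ_𝒮'} dim H¹_𝒮(K_v, T)/(H¹_𝒮(K_v, T) ∩ H¹_𝒮'(K_v, T))
(mod 2)`; proof: in the metabolic space `V = ⊕_{v ∈ Σ'} H¹(K_v, T)` the three subspaces
`X = ⊕ H¹_𝒮`, `Y = ⊕ H¹_𝒮'`, `Z = loc_{Σ'}(H¹(K_{Σ'}/K, T))` are Lagrangian (`Z^⊥ = Z` by
Poitou–Tate duality, `q(Z) = 0` by (ii)–(iii)), the Selmer groups surject onto `X ∩ Z`, `Y ∩ Z` with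
the same kernel, and Prop. 2.4 gives `dim X ∩ Z − dim Y ∩ Z ≡ dim X/(X ∩ Y)`.

## Rendering (abstract localisation data; what is an axiom here and why)

Everything in §3 that is *used* by Def 3.8 and Thm 3.9 is a statement about the following data,
over which this file is written: a field `F` (KMR: `𝔽_p`), a type `ι` of places, a global
`F`-space `H` (KMR: `H¹(K, T)`), local `F`-spaces `L v` (KMR: `H¹(K_v, T)`) with localisation maps
`loc v : H →ₗ[F] L v`, distinguished subspaces `Λ v ≤ L v` (KMR: `H¹_ur(K_v, T)`; only their
values at `v ∉ S₀` matter) and a finite `S₀ : Finset ι` (KMR's `Σ`).  Then: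

* `GlobalMetabolicStructure loc Λ S₀` (**Def 3.3**) = a quadratic form `form v` on each `L v`
  with (i) `IsMetabolic (form v)`; (ii′) `IsLagrangian (form v) (Λ v)` for `v ∉ S₀` — this is
  KMR's (ii) "`q_v(H¹_ur) = 0`" *together with* Thm 3.1(ii) "`H¹_ur = H¹_ur^⊥`", which for the
  cohomological data is a theorem (local Tate duality, Milne ADT I.2.6) but for abstract data
  must be required; (iii′) for every finite `S ⊇ S₀` and every `c ∈ H` with `loc v c ∈ Λ v` for all
  `v ∉ S`, `∑_{v ∈ S} form v (loc v c) = 0` — KMR's (iii) `∑_{all v} q_v(c_v) = 0` in the finitary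
  form in which it is used (the terms outside such an `S` vanish by (ii)), cf. the same device in
  `Literature/NumberTheory/GaloisCohomology/PoitouTate.lean`.  The *Tate* condition of Def 3.2
  (polar form = a prescribed pairing) is the predicate `GlobalMetabolicStructure.IsTateFor`.
* `QuadraticSelmerStructure 𝓆` (**Def 3.8**, the requested notion `quadraticSelmerStructure`) =
  `places ⊇ S₀` and local conditions `W v ≤ L v`, Lagrangian for `v ∈ places` and *equal to*
  `Λ v` off `places` (KMR define `H¹_𝒮(K_v, T)` only on `Σ_𝒮` and then set it `:= H¹_ur`
  elsewhere; we carry the total family with that constraint, so `W v` is Lagrangian at every `v`,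
  `isLagrangian`); `selmerGroup 𝒮 = ⨅_v (W v).comap (loc v)` is `H¹_𝒮(K, T)`; `lagrangians`,
  `ramifiedLagrangians` are **Def 3.6**; `unramifiedOutside`, `locPi`, `globalImage`, `piForm` are
  the objects `H¹(K_{Σ'}/K, T)`, `loc_{Σ'}`, `Z`, `(V, ∑ q_v)` of the proof of Thm 3.9.
* **Thm 3.9** is PROVED (`even_finrank_selmerGroup_add_sum`, and the `ℤ`-valued difference form
  `finrank_selmerGroup_sub_modEq` as printed) for abstract data under the two inputs its proof
  takes from arithmetic: `𝓆.IsSelfDualAt S` — "`Z^⊥ = Z` by Poitou–Tate global duality" for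
  `Z = loc_S({c : loc v c ∈ Λ v ∀ v ∉ S})` (for Galois cohomology: Milne ADT I.4.10; the tree's
  named fact `Literature.NumberTheory.GaloisCohomology.poitouTate_sum_localTatePairing_eq_zero` is
  the inclusion `Z ⊆ Z^⊥`), and finite dimension of that relaxed group (`H¹(K_S/K, T)` finite,
  Milne ADT I.4.15; the tree's `Literature/NumberTheory/EllipticCurves/H1UnramifiedFinite.lean`).
  Isotropy `q_S(Z) = 0` is derived from (ii′), (iii′) exactly as printed
  (`piForm_apply_eq_zero_of_mem_globalImage`); the three-Lagrangian step is the tree's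
  `Literature.LinearAlgebra.QuadraticForm.even_finrank_comap_add_finrank_comap_add_finrank_sub`.

Intended instances.  (a) KMR/Poonen–Rains: `F = 𝔽_p`, `H = H¹(K, T)`, `L v = H¹(K_v, T)` in the
tree's `Literature.NumberTheory.GaloisRepresentations.galoisCohomology` vocabulary
(`galoisCohomology.localization`), `q_v` the Poonen–Rains form of `E[2]` (Heisenberg group) or
`½⟨x, x⟩_v` for odd `p` (Lemma 3.4); the comparison with the tree's plain
`DiscreteGaloisModule.SelmerStructure` (a family of subgroups, no quadratic datum) is by
`selmerGroup`'s defining formula.  (b) The requesting route: `K = ℚ`, `T = E_t[2] ≅ Ind_{ℚ(i)}^ℚ 𝔽₂`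
constant along the pencil `y² = x((x+t)²+1)`, `H = ℚ(i)ˣ/ℚ(i)ˣ²` (Shapiro), `L v = (ℚ_v ⊗ ℚ(i))ˣ/□`,
`form v = ` the Hilbert-symbol form `(−Im α, N α)_v`, (iii′) = Hilbert reciprocity over `ℚ`,
`IsSelfDualAt` from the `S`-unit count in `ℤ[i]`; the Kummer images of the fibres are Selmer
structures for ONE `𝓆`, and Thm 3.9 is the relative parity of `dim Sel₂(E_t)`.

## Not here (deliberately)

The cohomological Tate quadratic forms themselves (Poonen–Rains' `q_{E,v}` via the Heisenberg /
theta group, O'Neil's isotropy of Kummer images, [PoonenRains2012] §4), the identification of a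
Selmer group of this file with the tree's `WeierstrassCurve.selmerGroup W 2` (exactness of the local
Kummer sequences, Silverman AEC X.4.2), Lemma 3.4 (uniqueness for odd `p`), Lemma 3.7 (the count
`|H_ram(q_v)| = p^{d_v − 1}`), and everything from §4 on (twisting data, disparity).  No named
facts are introduced: definitions with bodies and theorems only.

## References

* [KlagsbrunMazurRubin2013] Z. Klagsbrun, B. Mazur, K. Rubin, Disparity in Selmer ranks of
  quadratic twists of elliptic curves, Ann. of Math. (2) 178 (2013), 287–320, §3 (Thm 3.1,
  Def 3.2, Def 3.3, Def 3.6, Def 3.8, Thm 3.9). arXiv:1111.2321.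
* [PoonenRains2012] B. Poonen, E. Rains, Random maximal isotropic subspaces and Selmer groups,
  J. Amer. Math. Soc. 25 (2012), 245–269, §4 (the quadratic form on `H¹(K_v, E[2])`, Thm 4.14).
* [MazurRubin2007] B. Mazur, K. Rubin, Finding large Selmer rank via an arithmetic theory of local
  constants, Ann. of Math. 166 (2007), Thm 1.4 (Thm 3.9 for odd `p`).
* [MazurRubin2004] B. Mazur, K. Rubin, Kolyvagin systems, Mem. AMS 799 (2004), Def 2.1.1 (Selmer
  structures as families of local conditions).
-/

noncomputable section

namespace Literature.NumberTheory.EllipticCurves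

open Module QuadraticMap Literature.LinearAlgebra.QuadraticForm

universe u v w x

variable {F : Type u} [Field F] {ι : Type v} {H : Type w} [AddCommGroup H] [Module F H]
  {L : ι → Type x} [∀ v, AddCommGroup (L v)] [∀ v, Module F (L v)]

/-! ### Localisation data: relaxed classes, `loc_S`, the global image `Z` -/

section LocalizationData

variable (loc : ∀ v, H →ₗ[F] L v) (Λ : ∀ v, Submodule F (L v))

/-- The classes unramified outside `S`: `{c ∈ H : loc_v c ∈ Λ v for all v ∉ S}` (KMR, proof of
Thm 3.9: `ker (H¹(K, T) → ⊕_{v ∉ Σ'} H¹(K_v, T)/H¹_ur(K_v, T))`, i.e. `H¹(K_{Σ'}/K, T)` for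
`Λ = H¹_ur`). [cite: KlagsbrunMazurRubin2013, Thm. 3.9 (proof)] -/
def unramifiedOutside (S : Finset ι) : Submodule F H :=
  ⨅ (v : ι) (_ : v ∉ S), (Λ v).comap (loc v)

/-- Membership in `unramifiedOutside`. [cite: KlagsbrunMazurRubin2013, Thm. 3.9 (proof)] -/
@[simp] theorem mem_unramifiedOutside_iff (S : Finset ι) (c : H) :
    c ∈ unramifiedOutside loc Λ S ↔ ∀ v, v ∉ S → loc v c ∈ Λ v := by
  simp [unramifiedOutside]

/-- Enlarging `S` relaxes the condition. [cite: KlagsbrunMazurRubin2013, Thm. 3.9 (proof)] -/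
theorem unramifiedOutside_mono {S S' : Finset ι} (h : S ⊆ S') :
    unramifiedOutside loc Λ S ≤ unramifiedOutside loc Λ S' := fun c hc =>
  (mem_unramifiedOutside_iff loc Λ S' c).mpr fun v hv =>
    (mem_unramifiedOutside_iff loc Λ S c).mp hc v fun hvS => hv (h hvS)

/-- The product of the localisation maps at the places of `S`, `loc_S : H → ⊕_{v ∈ S} L v`
(KMR, proof of Thm 3.9: `loc_{Σ'}`). [cite: KlagsbrunMazurRubin2013, Thm. 3.9 (proof)] -/
def locPi (S : Finset ι) : H →ₗ[F] (∀ v : S, L v) :=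
  LinearMap.pi fun v : S => loc v

/-- `loc_S c = (loc_v c)_{v ∈ S}`. [cite: KlagsbrunMazurRubin2013, Thm. 3.9 (proof)] -/
@[simp] theorem locPi_apply (S : Finset ι) (c : H) (v : S) : locPi loc S c v = loc v c := rfl

/-- The image `Z = loc_S(unramifiedOutside S) ⊆ ⊕_{v ∈ S} L v` of the classes unramified outside
`S` (KMR, proof of Thm 3.9: the subspace `Z`). [cite: KlagsbrunMazurRubin2013, Thm. 3.9 (proof)] -/
def globalImage (S : Finset ι) : Submodule F (∀ v : S, L v) :=
  (unramifiedOutside loc Λ S).map (locPi loc S)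

/-- `Z` is the range of `loc_S` restricted to `unramifiedOutside S`.
[cite: KlagsbrunMazurRubin2013, Thm. 3.9 (proof)] -/
theorem range_locPi_comp_subtype (S : Finset ι) :
    LinearMap.range ((locPi loc S).comp (unramifiedOutside loc Λ S).subtype) =
      globalImage loc Λ S := by
  rw [LinearMap.range_comp, Submodule.range_subtype]
  rfl

end LocalizationData

/-! ### Global metabolic structures (KMR Def 3.3) -/

/-- A **global metabolic structure** (Klagsbrun–Mazur–Rubin 2013, Def. 3.3) on abstract
localisation data `(loc v : H →ₗ[F] L v)_v` with unramified subspaces `Λ v ≤ L v` and exceptional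
finite set `S₀` (KMR: `H = H¹(K, T)`, `L v = H¹(K_v, T)`, `Λ v = H¹_ur(K_v, T)`, `S₀ = Σ`): a quadratic
form `q_v = form v` on every `L v` such that (i) `(L v, q_v)` is a metabolic space; (ii′) for
`v ∉ S₀`, `Λ v` is Lagrangian for `q_v` (KMR (ii): `q_v(H¹_ur) = 0`, plus Thm 3.1(ii):
`H¹_ur = H¹_ur^⊥`); (iii′) for every finite `S ⊇ S₀` and every `c ∈ H` unramified outside `S`,
`∑_{v ∈ S} q_v(loc_v c) = 0` (KMR (iii): `∑_v q_v(c_v) = 0`). See the module docstring for the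
rendering. [cite: KlagsbrunMazurRubin2013, Def. 3.3] -/
structure GlobalMetabolicStructure (loc : ∀ v, H →ₗ[F] L v) (Λ : ∀ v, Submodule F (L v))
    (S₀ : Finset ι) where
  /-- the local quadratic forms `q_v` on `L v = H¹(K_v, T)`. -/
  form : ∀ v, QuadraticForm F (L v)
  /-- (i) every `(L v, q_v)` is a metabolic space. -/
  isMetabolic : ∀ v, IsMetabolic (form v)
  /-- (ii′) off `S₀` the unramified subspace is Lagrangian for `q_v`. -/
  isLagrangian_unramified : ∀ v, v ∉ S₀ → IsLagrangian (form v) (Λ v)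
  /-- (iii′) reciprocity: `∑_{v ∈ S} q_v(loc_v c) = 0` for `c` unramified outside `S ⊇ S₀`. -/
  sum_eq_zero : ∀ (S : Finset ι), S₀ ⊆ S → ∀ c : H, (∀ v, v ∉ S → loc v c ∈ Λ v) →
    ∑ v ∈ S, form v (loc v c) = 0

namespace GlobalMetabolicStructure

variable {loc : ∀ v, H →ₗ[F] L v} {Λ : ∀ v, Submodule F (L v)} {S₀ : Finset ι}
  (𝓆 : GlobalMetabolicStructure loc Λ S₀)

/-- KMR Def. 3.2 (abstract form): the forms `q_v` of `𝓆` are **Tate quadratic forms** for a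
prescribed family of local pairings `b v` on `L v` (KMR: the local Tate pairings `⟨ , ⟩_v` of
(3.1)) if the polar form of `q_v` is `b v` for every `v`. [cite: KlagsbrunMazurRubin2013, Def. 3.2] -/
def IsTateFor (b : ∀ v, LinearMap.BilinForm F (L v)) : Prop :=
  ∀ v, polarForm (𝓆.form v) = b v

/-- The polar forms `( , )_{q_v}` are nondegenerate. [cite: KlagsbrunMazurRubin2013, Def. 3.3] -/
theorem nondegenerate (v : ι) : (polarForm (𝓆.form v)).Nondegenerate :=
  (𝓆.isMetabolic v).1

/-- `q_v` vanishes off `S₀` on `Λ v` (KMR (ii): "`q_v` is unramified").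
[cite: KlagsbrunMazurRubin2013, Def. 3.3] -/
theorem form_apply_eq_zero_of_mem {v : ι} (hv : v ∉ S₀) {x : L v} (hx : x ∈ Λ v) :
    𝓆.form v x = 0 :=
  (𝓆.isLagrangian_unramified v hv).isTotallyIsotropic x hx

/-- The set `H(q_v)` of Lagrangian subspaces of `(L v, q_v)` (Klagsbrun–Mazur–Rubin 2013,
Def. 3.6). [cite: KlagsbrunMazurRubin2013, Def. 3.6] -/
def lagrangians (v : ι) : Set (Submodule F (L v)) :=
  {X | IsLagrangian (𝓆.form v) X}

/-- The set `H_ram(q_v) = {X ∈ H(q_v) : X ∩ H¹_ur(K_v, T) = 0}` of *ramified* Lagrangian subspaces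
(Klagsbrun–Mazur–Rubin 2013, Def. 3.6, there for `v ∉ Σ`). [cite: KlagsbrunMazurRubin2013, Def. 3.6] -/
def ramifiedLagrangians (v : ι) : Set (Submodule F (L v)) :=
  {X | X ∈ 𝓆.lagrangians v ∧ X ⊓ Λ v = ⊥}

/-- Membership in `H(q_v)`. [cite: KlagsbrunMazurRubin2013, Def. 3.6] -/
@[simp] theorem mem_lagrangians_iff (v : ι) (X : Submodule F (L v)) :
    X ∈ 𝓆.lagrangians v ↔ IsLagrangian (𝓆.form v) X :=
  Iff.rfl

/-- Membership in `H_ram(q_v)`. [cite: KlagsbrunMazurRubin2013, Def. 3.6] -/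
@[simp] theorem mem_ramifiedLagrangians_iff (v : ι) (X : Submodule F (L v)) :
    X ∈ 𝓆.ramifiedLagrangians v ↔ IsLagrangian (𝓆.form v) X ∧ X ⊓ Λ v = ⊥ :=
  Iff.rfl

/-- Off `S₀` the unramified subspace belongs to `H(q_v)` (KMR, proof of Lemma 3.7: "Theorem 3.1(ii)
shows that `H¹_ur(K_v, T)` is Lagrangian"). [cite: KlagsbrunMazurRubin2013, Lemma 3.7 (proof)] -/
theorem unramified_mem_lagrangians {v : ι} (hv : v ∉ S₀) : Λ v ∈ 𝓆.lagrangians v :=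
  𝓆.isLagrangian_unramified v hv

/-- Every member of `H(q_v)` has dimension `½ dim L v` (KMR Lemma 3.7(ii), for `v ∉ Σ`:
"every `X ∈ H(q_v)` has dimension `d_v`", `dim H¹(K_v, T) = 2 d_v`).
[cite: KlagsbrunMazurRubin2013, Lemma 3.7] -/
theorem two_mul_finrank_of_mem_lagrangians {v : ι} [FiniteDimensional F (L v)]
    {X : Submodule F (L v)} (hX : X ∈ 𝓆.lagrangians v) : 2 * finrank F X = finrank F (L v) :=
  IsLagrangian.two_mul_finrank (𝓆.nondegenerate v) hX

/-! #### The metabolic space `(⊕_{v ∈ S} L v, ∑_{v ∈ S} q_v)` and its Lagrangian `Z` -/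

/-- The orthogonal-sum form `q_S = ∑_{v ∈ S} q_v` on `V = ⊕_{v ∈ S} L v` (KMR, proof of Thm 3.9:
"`V = ∏_{v ∈ Σ'} H¹(K_v, T)`, so `(V, ∑_v q_v)` is a metabolic space").
[cite: KlagsbrunMazurRubin2013, Thm. 3.9 (proof)] -/
def piForm (S : Finset ι) : QuadraticForm F (∀ v : S, L v) :=
  QuadraticMap.pi fun v : S => 𝓆.form v

/-- `q_S(x) = ∑_{v ∈ S} q_v(x_v)`. [cite: KlagsbrunMazurRubin2013, Thm. 3.9 (proof)] -/
theorem piForm_apply (S : Finset ι) (x : ∀ v : S, L v) :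
    𝓆.piForm S x = ∑ v : S, 𝓆.form v (x v) :=
  QuadraticMap.pi_apply _ x

/-- `(⊕_{v ∈ S} L v, q_S)` is a metabolic space. [cite: KlagsbrunMazurRubin2013, Thm. 3.9 (proof)] -/
theorem isMetabolic_piForm (S : Finset ι) : IsMetabolic (𝓆.piForm S) :=
  IsMetabolic.pi fun v : S => 𝓆.isMetabolic v

/-- `q_S` vanishes on `Z` when `S ⊇ S₀`: for `z = loc_S(s)` with `s` unramified outside `S`,
`q_S(z) = ∑_{v ∈ S} q_v(s_v) = ∑_{all v} q_v(s_v) = 0` by (ii) and (iii) (KMR, proof of Thm 3.9,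
verbatim). [cite: KlagsbrunMazurRubin2013, Thm. 3.9 (proof)] -/
theorem piForm_apply_eq_zero_of_mem_globalImage {S : Finset ι} (hS : S₀ ⊆ S)
    {z : ∀ v : S, L v} (hz : z ∈ globalImage loc Λ S) : 𝓆.piForm S z = 0 := by
  obtain ⟨c, hc, rfl⟩ := Submodule.mem_map.mp hz
  rw [piForm_apply]
  simp only [locPi_apply]
  rw [Finset.sum_coe_sort S fun v => 𝓆.form v (loc v c)]
  exact 𝓆.sum_eq_zero S hS c ((mem_unramifiedOutside_iff loc Λ S c).mp hc)

/-- The **Poitou–Tate input** of Thm 3.9 at a finite set of places `S`: the image `Z` of the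
classes unramified outside `S` is its own orthogonal complement in `(⊕_{v ∈ S} L v, q_S)` (KMR,
proof of Thm 3.9: "We have `Z^⊥ = Z` by Poitou–Tate global duality"; Milne ADT I.4.10, Tate 1962).
For abstract data this is a hypothesis, whence a predicate. [cite: KlagsbrunMazurRubin2013, Thm. 3.9 (proof)] -/
def IsSelfDualAt (S : Finset ι) : Prop :=
  (polarForm (𝓆.piForm S)).orthogonal (globalImage loc Λ S) = globalImage loc Λ S

/-- Under the Poitou–Tate input, `Z` is Lagrangian in `(⊕_{v ∈ S} L v, q_S)` for `S ⊇ S₀` (KMR,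
proof of Thm 3.9: "Thus `Z` is Lagrangian"). [cite: KlagsbrunMazurRubin2013, Thm. 3.9 (proof)] -/
theorem isLagrangian_globalImage {S : Finset ι} (hS : S₀ ⊆ S) (hPT : 𝓆.IsSelfDualAt S) :
    IsLagrangian (𝓆.piForm S) (globalImage loc Λ S) :=
  ⟨hPT, fun _ hz => 𝓆.piForm_apply_eq_zero_of_mem_globalImage hS hz⟩

end GlobalMetabolicStructure

/-! ### Quadratic Selmer structures (KMR Def 3.8) and their Selmer groups -/

/-- A **(quadratic) Selmer structure** `𝒮` for a global metabolic structure `𝓆`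
(Klagsbrun–Mazur–Rubin 2013, Def. 3.8): a finite set of places `places = Σ_𝒮 ⊇ S₀` and local
conditions `W v ≤ L v` (KMR: `H¹_𝒮(K_v, T)`), Lagrangian for `q_v` at every `v ∈ places` and equal
to the unramified subspace `Λ v` at every `v ∉ places` (KMR: "we set `H¹_𝒮(K_v, T) := H¹_ur(K_v, T)`
if `v ∉ Σ_𝒮`"). This is the notion `quadraticSelmerStructure` of the definition request.
[cite: KlagsbrunMazurRubin2013, Def. 3.8] -/
structure QuadraticSelmerStructure {loc : ∀ v, H →ₗ[F] L v} {Λ : ∀ v, Submodule F (L v)}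
    {S₀ : Finset ι} (𝓆 : GlobalMetabolicStructure loc Λ S₀) where
  /-- the finite set `Σ_𝒮 ⊇ S₀` of places carrying a possibly non-unramified condition. -/
  places : Finset ι
  /-- `S₀ ⊆ Σ_𝒮`. -/
  subset_places : S₀ ⊆ places
  /-- the local conditions `H¹_𝒮(K_v, T) ≤ H¹(K_v, T)`. -/
  W : ∀ v, Submodule F (L v)
  /-- the local conditions are Lagrangian on `Σ_𝒮` … -/
  isLagrangian_of_mem : ∀ v, v ∈ places → IsLagrangian (𝓆.form v) (W v)
  /-- … and unramified off `Σ_𝒮`. -/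
  eq_unramified : ∀ v, v ∉ places → W v = Λ v

namespace QuadraticSelmerStructure

variable {loc : ∀ v, H →ₗ[F] L v} {Λ : ∀ v, Submodule F (L v)} {S₀ : Finset ι}
  {𝓆 : GlobalMetabolicStructure loc Λ S₀}

/-- Every local condition of a Selmer structure is Lagrangian (on `Σ_𝒮` by definition, off `Σ_𝒮`
because `H¹_ur` is, (ii′)). [cite: KlagsbrunMazurRubin2013, Def. 3.8] -/
theorem isLagrangian (𝒮 : QuadraticSelmerStructure 𝓆) (v : ι) :
    IsLagrangian (𝓆.form v) (𝒮.W v) := by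
  by_cases hv : v ∈ 𝒮.places
  · exact 𝒮.isLagrangian_of_mem v hv
  · rw [𝒮.eq_unramified v hv]
    exact 𝓆.isLagrangian_unramified v fun h => hv (𝒮.subset_places h)

/-- `W v ∈ H(q_v)` for every `v`. [cite: KlagsbrunMazurRubin2013, Def. 3.8] -/
theorem mem_lagrangians (𝒮 : QuadraticSelmerStructure 𝓆) (v : ι) : 𝒮.W v ∈ 𝓆.lagrangians v :=
  𝒮.isLagrangian v

/-- Constructor from Lagrangian conditions given on a finite set `S ⊇ S₀` only, extended by the
unramified subspaces elsewhere (exactly KMR's Def. 3.8). [cite: KlagsbrunMazurRubin2013, Def. 3.8] -/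
def ofLagrangians [DecidableEq ι] (S : Finset ι) (hS : S₀ ⊆ S) (X : ∀ v, Submodule F (L v))
    (hX : ∀ v, v ∈ S → IsLagrangian (𝓆.form v) (X v)) : QuadraticSelmerStructure 𝓆 where
  places := S
  subset_places := hS
  W v := if v ∈ S then X v else Λ v
  isLagrangian_of_mem v hv := by simpa only [if_pos hv] using hX v hv
  eq_unramified v hv := by simp only [if_neg hv]

/-- The local condition of `ofLagrangians` at `v ∈ S` is the given one.
[cite: KlagsbrunMazurRubin2013, Def. 3.8] -/
@[simp] theorem ofLagrangians_W_of_mem [DecidableEq ι] {S : Finset ι} (hS : S₀ ⊆ S)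
    {X : ∀ v, Submodule F (L v)} (hX : ∀ v, v ∈ S → IsLagrangian (𝓆.form v) (X v)) {v : ι}
    (hv : v ∈ S) : (ofLagrangians S hS X hX).W v = X v :=
  if_pos hv

/-- The local condition of `ofLagrangians` at `v ∉ S` is the unramified one.
[cite: KlagsbrunMazurRubin2013, Def. 3.8] -/
@[simp] theorem ofLagrangians_W_of_not_mem [DecidableEq ι] {S : Finset ι} (hS : S₀ ⊆ S)
    {X : ∀ v, Submodule F (L v)} (hX : ∀ v, v ∈ S → IsLagrangian (𝓆.form v) (X v)) {v : ι}
    (hv : v ∉ S) : (ofLagrangians S hS X hX).W v = Λ v :=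
  if_neg hv

/-- The **Selmer group** `H¹_𝒮(K, T) = {c ∈ H : loc_v c ∈ W v for every v}` of a quadratic Selmer
structure (Klagsbrun–Mazur–Rubin 2013, Def. 3.8:
`H¹_𝒮(K, T) := ker (H¹(K, T) → ⊕_v H¹(K_v, T)/H¹_𝒮(K_v, T))`). Same formula as the tree's
`Literature.NumberTheory.GaloisRepresentations.DiscreteGaloisModule.SelmerStructure.selmerGroup`
(Mazur–Rubin 2004, Def. 2.1.1). [cite: KlagsbrunMazurRubin2013, Def. 3.8] -/
def selmerGroup (𝒮 : QuadraticSelmerStructure 𝓆) : Submodule F H :=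
  ⨅ v, (𝒮.W v).comap (loc v)

/-- Membership in the Selmer group: all localisations satisfy the local conditions.
[cite: KlagsbrunMazurRubin2013, Def. 3.8] -/
@[simp] theorem mem_selmerGroup_iff (𝒮 : QuadraticSelmerStructure 𝓆) (c : H) :
    c ∈ 𝒮.selmerGroup ↔ ∀ v, loc v c ∈ 𝒮.W v := by
  simp [selmerGroup, Submodule.mem_iInf]

/-- A Selmer group consists of classes unramified outside `Σ_𝒮` (and outside any `S ⊇ Σ_𝒮`)
(KMR, proof of Thm 3.9). [cite: KlagsbrunMazurRubin2013, Thm. 3.9 (proof)] -/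
theorem selmerGroup_le_unramifiedOutside (𝒮 : QuadraticSelmerStructure 𝓆) {S : Finset ι}
    (hS : 𝒮.places ⊆ S) : 𝒮.selmerGroup ≤ unramifiedOutside loc Λ S := by
  intro c hc
  rw [mem_unramifiedOutside_iff]
  intro v hv
  rw [← 𝒮.eq_unramified v fun h => hv (hS h)]
  exact (𝒮.mem_selmerGroup_iff c).mp hc v

/-- The Selmer group is the preimage of `X = ⊕_{v ∈ S} W v` under `loc_S` restricted to the
classes unramified outside `S ⊇ Σ_𝒮` (KMR, proof of Thm 3.9: the exact sequence
`0 → A → H¹_𝒮(K, T) → X ∩ Z → 0`). [cite: KlagsbrunMazurRubin2013, Thm. 3.9 (proof)] -/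
theorem comap_locPi_pi_eq (𝒮 : QuadraticSelmerStructure 𝓆) {S : Finset ι} (hS : 𝒮.places ⊆ S) :
    (Submodule.pi Set.univ fun v : S => 𝒮.W v).comap
        ((locPi loc S).comp (unramifiedOutside loc Λ S).subtype) =
      𝒮.selmerGroup.comap (unramifiedOutside loc Λ S).subtype := by
  ext c
  simp only [Submodule.mem_comap, LinearMap.coe_comp, Function.comp_apply, Submodule.subtype_apply,
    Submodule.mem_pi, Set.mem_univ, true_imp_iff, locPi_apply, mem_selmerGroup_iff]
  refine ⟨fun h v => ?_, fun h v => h v⟩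
  by_cases hv : v ∈ S
  · exact h ⟨v, hv⟩
  · rw [𝒮.eq_unramified v fun h' => hv (hS h')]
    exact (mem_unramifiedOutside_iff loc Λ S (c : H)).mp c.2 v hv

/-! ### KMR Theorem 3.9 -/

section Comparison

variable [∀ v, FiniteDimensional F (L v)] (𝒮 𝒮' : QuadraticSelmerStructure 𝓆) {S : Finset ι}

/-- **KMR Theorem 3.9** (Klagsbrun–Mazur–Rubin 2013), parity form: "Suppose `𝒮` and `𝒮'` are two
Selmer structures for `T`. Then `dim H¹_𝒮(K, T) − dim H¹_𝒮'(K, T) ≡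
∑_{v ∈ Σ_𝒮 ∪ Σ_𝒮'} dim H¹_𝒮(K_v, T)/(H¹_𝒮(K_v, T) ∩ H¹_𝒮'(K_v, T)) (mod 2)`." Here for abstract
localisation data and any finite `S ⊇ Σ_𝒮 ∪ Σ_𝒮'` (the extra terms vanish), under the two
arithmetic inputs of the printed proof — Poitou–Tate self-duality of `Z = loc_S(H_S)`
(`IsSelfDualAt`) and finite dimension of `H_S = {c : c unramified outside S}` — and stated as the
evenness of `dim H¹_𝒮 + dim H¹_𝒮' + ∑_{v ∈ S} (dim W_v − dim W_v ∩ W'_v)`. Proof as printed: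
`X = ⊕ W_v`, `Y = ⊕ W'_v`, `Z` are Lagrangian in the metabolic space `(⊕_{v ∈ S} L v, q_S)`, the
Selmer groups are `loc_S⁻¹(X)`, `loc_S⁻¹(Y)` on `H_S`, Prop. 2.4 (through the tree's
`even_finrank_comap_add_finrank_comap_add_finrank_sub`) gives
`dim X ∩ Z − dim Y ∩ Z ≡ dim X − dim X ∩ Y`, and `dim X − dim X ∩ Y = ∑_v dim W_v/(W_v ∩ W'_v)`.
[cite: KlagsbrunMazurRubin2013, Thm. 3.9] -/
theorem even_finrank_selmerGroup_add_sum (hS : 𝒮.places ⊆ S) (hS' : 𝒮'.places ⊆ S)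
    (hfin : FiniteDimensional F (unramifiedOutside loc Λ S)) (hPT : 𝓆.IsSelfDualAt S) :
    Even (finrank F 𝒮.selmerGroup + finrank F 𝒮'.selmerGroup +
      ∑ v ∈ S, (finrank F (𝒮.W v) - finrank F ↥(𝒮.W v ⊓ 𝒮'.W v))) := by
  have hS₀ : S₀ ⊆ S := 𝒮.subset_places.trans hS
  -- the three Lagrangians `X, Y, Z` of the metabolic space `⊕_{v ∈ S} L v`
  have hmet : IsMetabolic (𝓆.piForm S) := 𝓆.isMetabolic_piForm S
  have hX : IsLagrangian (𝓆.piForm S) (Submodule.pi Set.univ fun v : S => 𝒮.W v) :=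
    IsLagrangian.pi fun v : S => 𝒮.isLagrangian v
  have hY : IsLagrangian (𝓆.piForm S) (Submodule.pi Set.univ fun v : S => 𝒮'.W v) :=
    IsLagrangian.pi fun v : S => 𝒮'.isLagrangian v
  have hZ : IsLagrangian (𝓆.piForm S)
      (LinearMap.range ((locPi loc S).comp (unramifiedOutside loc Λ S).subtype)) := by
    rw [range_locPi_comp_subtype]
    exact 𝓆.isLagrangian_globalImage hS₀ hPT
  -- Proposition 2.4, through the algebraic skeleton of Thm 3.9
  have key := even_finrank_comap_add_finrank_comap_add_finrank_sub hmet.1 hX hY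
    ((locPi loc S).comp (unramifiedOutside loc Λ S).subtype) hZ
  rw [𝒮.comap_locPi_pi_eq hS, 𝒮'.comap_locPi_pi_eq hS',
    (Submodule.comapSubtypeEquivOfLe (𝒮.selmerGroup_le_unramifiedOutside hS)).finrank_eq,
    (Submodule.comapSubtypeEquivOfLe (𝒮'.selmerGroup_le_unramifiedOutside hS')).finrank_eq,
    pi_inf_pi, finrank_pi_eq_sum, finrank_pi_eq_sum,
    Finset.sum_coe_sort S fun v => finrank F (𝒮.W v),
    Finset.sum_coe_sort S fun v => finrank F ↥(𝒮.W v ⊓ 𝒮'.W v)] at key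
  have hle : ∀ v ∈ S, finrank F ↥(𝒮.W v ⊓ 𝒮'.W v) ≤ finrank F (𝒮.W v) := fun v _ =>
    Submodule.finrank_mono inf_le_left
  rwa [Finset.sum_tsub_distrib S hle]

/-- **KMR Theorem 3.9** (Klagsbrun–Mazur–Rubin 2013), as printed (integer difference form):
`dim H¹_𝒮(K, T) − dim H¹_𝒮'(K, T) ≡ ∑_{v ∈ S} dim H¹_𝒮(K_v, T)/(H¹_𝒮(K_v, T) ∩ H¹_𝒮'(K_v, T)) (mod 2)`
for any finite `S ⊇ Σ_𝒮 ∪ Σ_𝒮'`, under the Poitou–Tate and finiteness inputs (see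
`even_finrank_selmerGroup_add_sum`). [cite: KlagsbrunMazurRubin2013, Thm. 3.9] -/
theorem finrank_selmerGroup_sub_modEq (hS : 𝒮.places ⊆ S) (hS' : 𝒮'.places ⊆ S)
    (hfin : FiniteDimensional F (unramifiedOutside loc Λ S)) (hPT : 𝓆.IsSelfDualAt S) :
    ((finrank F 𝒮.selmerGroup : ℤ) - finrank F 𝒮'.selmerGroup) ≡
      ∑ v ∈ S, ((finrank F (𝒮.W v) : ℤ) - finrank F ↥(𝒮.W v ⊓ 𝒮'.W v)) [ZMOD 2] := by
  have h := 𝒮.even_finrank_selmerGroup_add_sum 𝒮' hS hS' hfin hPT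
  have hle : ∀ v ∈ S, finrank F ↥(𝒮.W v ⊓ 𝒮'.W v) ≤ finrank F (𝒮.W v) := fun v _ =>
    Submodule.finrank_mono inf_le_left
  have hcast : (∑ v ∈ S, ((finrank F (𝒮.W v) : ℤ) - finrank F ↥(𝒮.W v ⊓ 𝒮'.W v))) =
      ((∑ v ∈ S, (finrank F (𝒮.W v) - finrank F ↥(𝒮.W v ⊓ 𝒮'.W v)) : ℕ) : ℤ) := by
    rw [Nat.cast_sum]
    exact Finset.sum_congr rfl fun v hv => (Nat.cast_sub (hle v hv)).symm
  obtain ⟨k, hk⟩ := h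
  rw [Int.modEq_iff_dvd, hcast]
  exact ⟨(k : ℤ) - finrank F 𝒮.selmerGroup, by omega⟩

end Comparison

/-! #### `F = 𝔽_p`: the comparison in terms of orders of Selmer groups -/

section ZModP

variable {p : ℕ} [Fact p.Prime] {ι' : Type v} {H' : Type w} [AddCommGroup H'] [Module (ZMod p) H']
  {L' : ι' → Type x} [∀ v, AddCommGroup (L' v)] [∀ v, Module (ZMod p) (L' v)]
  [∀ v, FiniteDimensional (ZMod p) (L' v)]
  {loc : ∀ v, H' →ₗ[ZMod p] L' v} {Λ : ∀ v, Submodule (ZMod p) (L' v)} {S₀ : Finset ι'}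
  {𝓆 : GlobalMetabolicStructure loc Λ S₀}

/-- **KMR Theorem 3.9 over `𝔽_p`, with Selmer groups measured by their orders** (the currency of
the tree's `p`-Selmer statements, `#Sel = p^s`): if `#H¹_𝒮(K, T) = p^s` and `#H¹_𝒮'(K, T) = p^{s'}`
then `s + s' + ∑_{v ∈ S} dim_{𝔽_p} W_v/(W_v ∩ W'_v)` is even, i.e.
`s − s' ≡ ∑_v dim W_v/(W_v ∩ W'_v) (mod 2)`. [cite: KlagsbrunMazurRubin2013, Thm. 3.9] -/
theorem even_of_natCard_selmerGroup_eq_pow (𝒮 𝒮' : QuadraticSelmerStructure 𝓆) {S : Finset ι'}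
    (hS : 𝒮.places ⊆ S) (hS' : 𝒮'.places ⊆ S)
    (hfin : FiniteDimensional (ZMod p) (unramifiedOutside loc Λ S)) (hPT : 𝓆.IsSelfDualAt S)
    {s s' : ℕ} (hs : Nat.card 𝒮.selmerGroup = p ^ s) (hs' : Nat.card 𝒮'.selmerGroup = p ^ s') :
    Even (s + s' + ∑ v ∈ S, (finrank (ZMod p) (𝒮.W v) - finrank (ZMod p) ↥(𝒮.W v ⊓ 𝒮'.W v))) := by
  have h := 𝒮.even_finrank_selmerGroup_add_sum 𝒮' hS hS' hfin hPT
  have hp : 2 ≤ p := (Fact.out : p.Prime).two_le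
  have key : ∀ 𝒯 : QuadraticSelmerStructure 𝓆, 𝒯.places ⊆ S → ∀ t : ℕ,
      Nat.card 𝒯.selmerGroup = p ^ t → finrank (ZMod p) 𝒯.selmerGroup = t := by
    intro 𝒯 h𝒯 t ht
    haveI : FiniteDimensional (ZMod p) 𝒯.selmerGroup :=
      Submodule.finiteDimensional_of_le (𝒯.selmerGroup_le_unramifiedOutside h𝒯)
    haveI : Finite 𝒯.selmerGroup := Module.finite_of_finite (ZMod p)
    have e := Literature.GroupTheory.FiniteAbelian.pow_finrank_eq_natCard p 𝒯.selmerGroup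
    rw [ht] at e
    exact Nat.pow_right_injective hp e
  rwa [key 𝒮 hS s hs, key 𝒮' hS' s' hs'] at h

end ZModP

end QuadraticSelmerStructure

end Literature.NumberTheory.EllipticCurves
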